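import Mathlib
import Summits.Ventures.HodgeRepro2.T5ConductorParityAssembly

/-! # T5LocalFieldDictionary — the AKLB dictionary for a DVR extension: basis, different, primes

Blind cell pub-hodge-repro2, seat p4 (Tier-5 kernel annex, README §7; record-class, cited by p-id
or ignored, never an input). README §8(d): uses an L-value-free non-vanishing device: NO.

The capstone `T5ConductorParityAssembly.even_conductor_of_different` (p394322) takes as hypotheses
several «dictionary» facts about `O_{E_v}/O_{F_v}` that the prose of (A13) (route/T5-route-2.md
§N5.13.2) uses silently. For discrete valuation rings `A ⊆ B` in Mathlib's AKLB setting they are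
theorems:
* `nonempty_basis_fin_two` : `B` is free of rank `[L : K]` over `A` — a basis indexed by `Fin 2`
  when `[L : K] = 2` (`IsIntegralClosure.finite`, `IsIntegralClosure.rank`,
  `Module.free_of_finite_type_torsion_free'`);
* `isSeparable_fractionRing` : separability transported to `FractionRing A / FractionRing B`;
* `exists_differentIdeal_eq_span_pow` : `𝔇 = (π^d) = P^d` for a uniformiser `π` of `B`
  (`differentIdeal_ne_bot`, `IsDiscreteValuationRing.ideal_eq_span_pow_irreducible`);
* `span_isMaximal` / `span_liesOver` : `P = (π)` is the maximal ideal of `B` and lies over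
  `p = (ϖ)`, the maximal ideal of `A` (`Ideal.isMaximal_comap_of_isIntegral_of_isMaximal`,
  `IsLocalRing.eq_maximalIdeal`);
* `even_conductor_of_dvr` : the capstone restated with these hypotheses DERIVED — what remains:
  `[L : K] = 2`, a uniformiser `ϖ` of `A` with `v_F(ϖ) = exp(−1)`, residue degree `1`, `v_F ≤ 1`,
  `√D ∈ B ∖ A`, `δ = c √D`, the «`v_E = 2 v_F`» readings, and the printed conductor formula.

Stays prose: `e = 2`, `f = 1` at a ramified quadratic place (the fundamental identity
`e f = [L : K]` is Mathlib's `Ideal.sum_ramification_inertia`, not instantiated here), and the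
valuation dictionary `v_E ∘ algebraMap = v_F^e`.
-/

namespace Summit.Ventures.HodgeRepro2.T5LocalFieldDictionary

open Summit.Ventures.HodgeRepro2
open scoped WithZero nonZeroDivisors

attribute [local instance] FractionRing.liftAlgebra FractionRing.isScalarTower_liftAlgebra

section Injective

variable (A K L B : Type*) [CommRing A] [Field K] [CommRing B] [Field L]
  [Algebra A K] [Algebra B L] [Algebra A B] [Algebra K L] [Algebra A L]
  [IsScalarTower A K L] [IsScalarTower A B L] [IsFractionRing A K]

include K L in
/-- `algebraMap A B` is injective (`A → K → L` factors through `B`). -/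
theorem algebraMap_injective : Function.Injective (algebraMap A B) := by
  intro a a' h
  have h' : algebraMap A L a = algebraMap A L a' := by
    rw [IsScalarTower.algebraMap_apply A B L, h, ← IsScalarTower.algebraMap_apply]
  rw [IsScalarTower.algebraMap_apply A K L, IsScalarTower.algebraMap_apply A K L a'] at h'
  exact IsFractionRing.injective A K ((algebraMap K L).injective h')

include K L in
/-- `B` is torsion-free over `A` (so the hypothesis `[Module.IsTorsionFree A B]` of the section
below is automatic). -/
theorem isTorsionFree [IsDomain A] [IsDomain B] : Module.IsTorsionFree A B :=
  haveI : FaithfulSMul A B :=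
    (faithfulSMul_iff_algebraMap_injective A B).mpr (algebraMap_injective A K L B)
  inferInstance

include K in
/-- `L` is torsion-free over `A`. -/
theorem isTorsionFree_field [IsDomain A] : Module.IsTorsionFree A L :=
  haveI : FaithfulSMul A L := (faithfulSMul_iff_algebraMap_injective A L).mpr
    (by rw [IsScalarTower.algebraMap_eq A K L]
        exact (algebraMap K L).injective.comp (IsFractionRing.injective A K))
  inferInstance

end Injective

section DVR

/-- `(π)` is the maximal ideal of a discrete valuation ring `R` for a uniformiser `π`, hence
maximal. -/
theorem span_isMaximal {R : Type*} [CommRing R] [IsDomain R] [IsDiscreteValuationRing R] (π : R)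
    (hπ : Irreducible π) : (Ideal.span {π}).IsMaximal := by
  rw [← (IsDiscreteValuationRing.irreducible_iff_uniformizer π).1 hπ]
  exact IsLocalRing.maximalIdeal.isMaximal R

end DVR

section Dictionary

variable (A K L B : Type*) [CommRing A] [Field K] [CommRing B] [Field L]
  [Algebra A K] [Algebra B L] [Algebra A B] [Algebra K L] [Algebra A L]
  [IsScalarTower A K L] [IsScalarTower A B L]
  [IsDomain A] [IsDiscreteValuationRing A] [IsFractionRing A K] [FiniteDimensional K L]
  [Algebra.IsSeparable K L] [IsIntegralClosure B A L] [IsDomain B] [IsDiscreteValuationRing B]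
  [IsFractionRing B L] [Module.IsTorsionFree A B]

omit [IsDomain B] [IsDiscreteValuationRing B] [IsFractionRing B L] [Module.IsTorsionFree A B] in
include K L in
/-- `B` is a finite `A`-module. -/
theorem finite : Module.Finite A B := IsIntegralClosure.finite A K L B

omit [IsDomain B] [IsDiscreteValuationRing B] [IsFractionRing B L] in
/-- `B` is free of rank `[L : K]` over `A`: a basis indexed by `Fin 2` when `[L : K] = 2`. -/
theorem nonempty_basis_fin_two (hdim : Module.finrank K L = 2) :
    Nonempty (Module.Basis (Fin 2) A B) := by
  haveI := finite A K L B
  haveI := isTorsionFree_field A K L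
  haveI : Module.Free A B := Module.free_of_finite_type_torsion_free'
  exact ⟨Module.finBasisOfFinrankEq A B (by rw [IsIntegralClosure.rank A K L B, hdim])⟩

omit [IsDiscreteValuationRing A] [FiniteDimensional K L] [IsIntegralClosure B A L] in
include K L in
/-- Separability of `L / K` transported to the fraction rings `FractionRing A / FractionRing B`
(Mathlib's pattern in `coeSubmodule_differentIdeal`). -/
theorem isSeparable_fractionRing : Algebra.IsSeparable (FractionRing A) (FractionRing B) := by
  have H : RingHom.comp (algebraMap (FractionRing A) (FractionRing B))
      ↑(FractionRing.algEquiv A K).symm.toRingEquiv =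
        RingHom.comp ↑(FractionRing.algEquiv B L).symm.toRingEquiv (algebraMap K L) := by
    apply IsLocalization.ringHom_ext A⁰
    ext
    simp only [RingHom.coe_comp, RingHom.coe_coe, AlgEquiv.coe_ringEquiv, Function.comp_apply,
      AlgEquiv.commutes, ← IsScalarTower.algebraMap_apply]
    rw [IsScalarTower.algebraMap_apply A B L, AlgEquiv.commutes, ← IsScalarTower.algebraMap_apply]
  exact Algebra.IsSeparable.of_equiv_equiv _ _ H

include K L in
/-- The different ideal is `(π ^ d)` for a uniformiser `π` of `B` and some `d`. -/
theorem exists_differentIdeal_eq_span_pow (π : B) (hπ : Irreducible π) :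
    ∃ d : ℕ, differentIdeal A B = Ideal.span {π ^ d} := by
  haveI := finite A K L B
  haveI := isSeparable_fractionRing A K L B
  exact IsDiscreteValuationRing.ideal_eq_span_pow_irreducible differentIdeal_ne_bot hπ

omit [Field K] [Algebra A K] [Algebra K L] [IsScalarTower A K L] [IsFractionRing A K]
  [FiniteDimensional K L] [Algebra.IsSeparable K L] [IsFractionRing B L]
  [Module.IsTorsionFree A B] in
include L in
/-- `(π)` lies over `(ϖ)` for uniformisers `π` of `B` and `ϖ` of `A`. -/
theorem span_liesOver (π : B) (hπ : Irreducible π) (ϖ : A) (hϖ : Irreducible ϖ) :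
    (Ideal.span {π}).LiesOver (Ideal.span {ϖ}) := by
  haveI : Algebra.IsIntegral A B := IsIntegralClosure.isIntegral_algebra A L
  haveI := span_isMaximal π hπ
  have hmax : (Ideal.comap (algebraMap A B) (Ideal.span {π})).IsMaximal :=
    Ideal.isMaximal_comap_of_isIntegral_of_isMaximal (Ideal.span {π})
  refine ⟨?_⟩
  rw [Ideal.under_def, IsLocalRing.eq_maximalIdeal hmax,
    ← (IsDiscreteValuationRing.irreducible_iff_uniformizer ϖ).1 hϖ]

end Dictionary

section Restatement

variable (A K L B : Type*) [CommRing A] [Field K] [CommRing B] [Field L]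
  [Algebra A K] [Algebra B L] [Algebra A B] [Algebra K L] [Algebra A L]
  [IsScalarTower A K L] [IsScalarTower A B L]
  [IsDomain A] [IsDiscreteValuationRing A] [IsFractionRing A K] [FiniteDimensional K L]
  [Algebra.IsSeparable K L] [IsIntegralClosure B A L] [IsDomain B] [IsDiscreteValuationRing B]
  [IsFractionRing B L] [PerfectField (FractionRing A)] [Module.IsTorsionFree A B]

/-- **(A13) for a quadratic extension of discrete valuation rings**: the capstone
`T5ConductorParityAssembly.even_conductor_of_different` with the dictionary hypotheses DERIVED
(basis of `B`, `𝔇 = (π^d) = (π)^d`, `(π)` maximal over `(ϖ)`, localization; the instance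
`[Module.IsTorsionFree A B]` needed to even state `differentIdeal A B` is `isTorsionFree`).
What remains: `[L : K] = 2`; uniformisers `π` of `B`, `ϖ` of `A` with `v_F(ϖ) = exp(−1)`; `d` the
different exponent (`𝔇 = (π^d)`); residue degree `1`; `v_F ≤ 1` on `A`; `√D ∈ B ∖ A` with
`v_F(D) ≠ 0`, `v_F(2) ≠ 0`; `δ = c √D`; the two «`v_E = 2 v_F`» readings; the printed conductor
formula (its right-hand side `2n + v_E(δ) + d` is shown even). -/
theorem even_conductor_of_dvr (hdim : Module.finrank K L = 2) (π : B) (hπ : Irreducible π)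
    (ϖ : A) (hϖ : Irreducible ϖ) (d : ℕ) (hd : differentIdeal A B = Ideal.span {π ^ d})
    (hf : (Ideal.span {π}).inertiaDeg A = 1)
    (vF : Valuation A ℤᵐ⁰) (hvF : ∀ a : A, vF a ≤ 1) (hϖv : vF ϖ = WithZero.exp (-1))
    (s : B) (D : A) (hs : s * s = algebraMap A B D) (hns : s ∉ Set.range (algebraMap A B))
    (hD0 : vF D ≠ 0) (h2 : vF 2 ≠ 0)
    (vE : Valuation L ℤᵐ⁰) (δ : L) (c : K) (hc : c ≠ 0)
    (hδ : δ = algebraMap K L c * algebraMap B L s) (k : ℤ)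
    (hck : vE (algebraMap K L c) = WithZero.exp (-(2 * k)))
    (hDE : vE (algebraMap K L (algebraMap A K D)) =
      WithZero.exp (-(2 * (-WithZero.log (vF D)))))
    (n : ℤ) :
    Even (2 * n + T5RamifiedParity.ord vE δ + (d : ℤ)) := by
  haveI : IsLocalization (Algebra.algebraMapSubmonoid B A⁰) L :=
    T5DifferentNorm.isLocalization_algebraMapSubmonoid A K L B
  obtain ⟨b⟩ := nonempty_basis_fin_two A K L B hdim
  haveI : (Ideal.span {π}).IsMaximal := span_isMaximal π hπ
  haveI : (Ideal.span {ϖ}).IsMaximal := span_isMaximal ϖ hϖ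
  haveI : (Ideal.span {π}).LiesOver (Ideal.span {ϖ}) := span_liesOver A L B π hπ ϖ hϖ
  have hD : differentIdeal A B = Ideal.span {π} ^ d := by rw [hd, Ideal.span_singleton_pow]
  exact T5ConductorParityAssembly.even_conductor_of_different A K L B b vF hvF ϖ hϖv
    (Ideal.span {π}) hf d hD (π ^ d) hd (pow_ne_zero _ hπ.ne_zero) s D hs hns hD0 h2 vE δ c hc hδ
    k hck hDE n

end Restatement

end Summit.Ventures.HodgeRepro2.T5LocalFieldDictionary
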